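import Summits.CriticalPhenomena.PercolationContinuityZ3.Theorems.PercNearOneGluingNoHeavyLowerTailAntitheticCyclePlusBoundary
import HarnessLib

/-!
# `NoHeavyLowerTail` (stmt-CriticalPhenomena-4575) — antithetic cluster pairs: THEOREM C′, the BOUNDARY COUNT, part 2 — THRESHOLDS of an upper set
# along the lifted run chains (prim-hp-2 gen 44; HOME/THEOREM-Cprime-delta2-cycle.md §6 "THRESHOLDS", "CONSTRAINTS", "GOODS")

Support file (`--supports stmt-CriticalPhenomena-4575`, hull-port prover `prim-hp-2`, gen 44).  No named facts, no sorries; standard axioms.  The `def`s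
`Cyc.Bulk.{thrP, thrQ}` are proof-internal bookkeeping.

SETTING: cycle `v 0 = s, …, v (n−1)` (…CycleRuns), run sets `runSet a b` (…CyclePlusBulk), a base vertex `u` (one of `y = v p`, `z = v q`) with its
marker pair `m` (one of `e = xy`, `f = xz`) and the pendant lift `L = Pendant.liftSet s u m`.  The lifted clusters of the boundary colourings of THEOREM C′
are the CHAIN elements `L(runSet i 0)` (clockwise runs), `L(runSet 0 j)` (counter-clockwise runs), the ARCS `L(runSet k (n−1−k))` and the FULL set
`L(runSet n n)`.  For an upper set `U`:
* `Cyc.Bulk.thrP U` / `thrQ U` — the least `i ≥ 1` with `L(runSet i 0) ∈ U` (resp. `L(runSet 0 i) ∈ U`), or `n` if there is none below `n`;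
* `mem_iff_thrP_le`, `mem_iff_thrQ_le` — for `1 ≤ i < n`, membership of the chain element is the threshold condition;
* `thrP_le_of_lt`, `thrQ_le_of_lt` — the CONSTRAINTS: below the position of the base vertex the lift is trivial, so the chain for `(u, m)` is contained
  in the chain for any other `(u′, m′)` there (`ar < p → ab ≤ ar` … of the abstract count …AntitheticBoundaryCount);
* `arc_mem_of_thrP_le`, `arc_mem_of_thrQ_le`, `full_mem_of_thrP_lt`, `full_mem_of_thrQ_lt` — the GOODS: arcs and the full set contain the chains.
[cite: VandenbergHaggstromKahn2005, §1 p. 3 (open cluster `C_s`)]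
-/

noncomputable section

namespace Summit.CriticalPhenomena.PercolationContinuityZ3.Theorems

open Literature.Probability.Percolation
open scoped Classical symmDiff

namespace Antithetic

namespace Cyc

namespace Bulk

variable {V : Type*} (n : ℕ) (v : ℕ → V) (u : V) (m : Sym2 V) (U : Set (Set (Sym2 V)))

/-- Threshold of `U` along the clockwise lifted chain: the least `i` with `i = n ∨ (1 ≤ i ∧ L(runSet i 0) ∈ U)`. [this work] -/
def thrP : ℕ := Nat.find (⟨n, Or.inl rfl⟩ : ∃ i, i = n ∨ (1 ≤ i ∧ Pendant.liftSet (v 0) u m (runSet n v i 0) ∈ U))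

/-- Threshold of `U` along the counter-clockwise lifted chain: the least `j` with `j = n ∨ (1 ≤ j ∧ L(runSet 0 j) ∈ U)`. [this work] -/
def thrQ : ℕ := Nat.find (⟨n, Or.inl rfl⟩ : ∃ j, j = n ∨ (1 ≤ j ∧ Pendant.liftSet (v 0) u m (runSet n v 0 j) ∈ U))

variable {n v u m U}

section Basic

/-- `thrP ≤ n`. [this work] -/
theorem thrP_le : thrP n v u m U ≤ n := Nat.find_le (Or.inl rfl)

/-- `thrQ ≤ n`. [this work] -/
theorem thrQ_le : thrQ n v u m U ≤ n := Nat.find_le (Or.inl rfl)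

/-- `1 ≤ thrP` (for `1 ≤ n`). [this work] -/
theorem one_le_thrP (hn : 1 ≤ n) : 1 ≤ thrP n v u m U := by
  have h := Nat.find_spec (⟨n, Or.inl rfl⟩ : ∃ i, i = n ∨ (1 ≤ i ∧ Pendant.liftSet (v 0) u m (runSet n v i 0) ∈ U))
  change thrP n v u m U = n ∨ (1 ≤ thrP n v u m U ∧ _) at h
  rcases h with h | h
  · omega
  · exact h.1

/-- `1 ≤ thrQ` (for `1 ≤ n`). [this work] -/
theorem one_le_thrQ (hn : 1 ≤ n) : 1 ≤ thrQ n v u m U := by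
  have h := Nat.find_spec (⟨n, Or.inl rfl⟩ : ∃ j, j = n ∨ (1 ≤ j ∧ Pendant.liftSet (v 0) u m (runSet n v 0 j) ∈ U))
  change thrQ n v u m U = n ∨ (1 ≤ thrQ n v u m U ∧ _) at h
  rcases h with h | h
  · omega
  · exact h.1

/-- If `thrP < n` the chain element at the threshold lies in `U`. [this work] -/
theorem mem_at_thrP (h : thrP n v u m U < n) : Pendant.liftSet (v 0) u m (runSet n v (thrP n v u m U) 0) ∈ U := by
  have hs := Nat.find_spec (⟨n, Or.inl rfl⟩ : ∃ i, i = n ∨ (1 ≤ i ∧ Pendant.liftSet (v 0) u m (runSet n v i 0) ∈ U))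
  change thrP n v u m U = n ∨ (1 ≤ thrP n v u m U ∧ Pendant.liftSet (v 0) u m (runSet n v (thrP n v u m U) 0) ∈ U) at hs
  rcases hs with hs | hs
  · omega
  · exact hs.2

/-- If `thrQ < n` the chain element at the threshold lies in `U`. [this work] -/
theorem mem_at_thrQ (h : thrQ n v u m U < n) : Pendant.liftSet (v 0) u m (runSet n v 0 (thrQ n v u m U)) ∈ U := by
  have hs := Nat.find_spec (⟨n, Or.inl rfl⟩ : ∃ j, j = n ∨ (1 ≤ j ∧ Pendant.liftSet (v 0) u m (runSet n v 0 j) ∈ U))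
  change thrQ n v u m U = n ∨ (1 ≤ thrQ n v u m U ∧ Pendant.liftSet (v 0) u m (runSet n v 0 (thrQ n v u m U)) ∈ U) at hs
  rcases hs with hs | hs
  · omega
  · exact hs.2

/-- A chain member in `U` bounds the threshold. [this work] -/
theorem thrP_le_of_mem {i : ℕ} (hi : 1 ≤ i) (h : Pendant.liftSet (v 0) u m (runSet n v i 0) ∈ U) : thrP n v u m U ≤ i :=
  Nat.find_le (Or.inr ⟨hi, h⟩)

/-- A chain member in `U` bounds the threshold (counter-clockwise). [this work] -/
theorem thrQ_le_of_mem {j : ℕ} (hj : 1 ≤ j) (h : Pendant.liftSet (v 0) u m (runSet n v 0 j) ∈ U) : thrQ n v u m U ≤ j :=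
  Nat.find_le (Or.inr ⟨hj, h⟩)

variable (hU : IsUpperSet U)
include hU

/-- **Threshold form of chain membership** (clockwise): for `1 ≤ i < n`, `L(runSet i 0) ∈ U ↔ thrP ≤ i`. [this work] -/
theorem mem_iff_thrP_le {i : ℕ} (hi : 1 ≤ i) (hin : i < n) : Pendant.liftSet (v 0) u m (runSet n v i 0) ∈ U ↔ thrP n v u m U ≤ i := by
  refine ⟨thrP_le_of_mem hi, fun h => ?_⟩
  exact hU (Pendant.liftSet_mono _ _ _ (runSet_mono h le_rfl)) (mem_at_thrP (lt_of_le_of_lt h hin))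

/-- **Threshold form of chain membership** (counter-clockwise): for `1 ≤ j < n`, `L(runSet 0 j) ∈ U ↔ thrQ ≤ j`. [this work] -/
theorem mem_iff_thrQ_le {j : ℕ} (hj : 1 ≤ j) (hjn : j < n) : Pendant.liftSet (v 0) u m (runSet n v 0 j) ∈ U ↔ thrQ n v u m U ≤ j := by
  refine ⟨thrQ_le_of_mem hj, fun h => ?_⟩
  exact hU (Pendant.liftSet_mono _ _ _ (runSet_mono le_rfl h)) (mem_at_thrQ (lt_of_le_of_lt h hjn))

/-- GOODS, arcs ⊇ clockwise chain: `thrP ≤ k < n` puts the lifted arc `L(runSet k b)` in `U` (any `b`). [this work] -/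
theorem arc_mem_of_thrP_le {k b : ℕ} (hk : thrP n v u m U ≤ k) (hkn : k < n) : Pendant.liftSet (v 0) u m (runSet n v k b) ∈ U :=
  hU (Pendant.liftSet_mono _ _ _ (runSet_mono le_rfl (Nat.zero_le _))) ((mem_iff_thrP_le hU ((one_le_thrP (by omega)).trans hk) hkn).2 hk)

/-- GOODS, arcs ⊇ counter-clockwise chain: `thrQ ≤ b < n` puts `L(runSet k b)` in `U` (any `k`). [this work] -/
theorem arc_mem_of_thrQ_le {k b : ℕ} (hb : thrQ n v u m U ≤ b) (hbn : b < n) : Pendant.liftSet (v 0) u m (runSet n v k b) ∈ U :=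
  hU (Pendant.liftSet_mono _ _ _ (runSet_mono (Nat.zero_le _) le_rfl)) ((mem_iff_thrQ_le hU ((one_le_thrQ (by omega)).trans hb) hbn).2 hb)

/-- GOODS, the full set: `thrP < n` puts `L(runSet n n)` in `U`. [this work] -/
theorem full_mem_of_thrP_lt (h : thrP n v u m U < n) : Pendant.liftSet (v 0) u m (runSet n v n n) ∈ U :=
  hU (Pendant.liftSet_mono _ _ _ (runSet_mono thrP_le (Nat.zero_le _))) (mem_at_thrP h)

/-- GOODS, the full set: `thrQ < n` puts `L(runSet n n)` in `U`. [this work] -/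
theorem full_mem_of_thrQ_lt (h : thrQ n v u m U < n) : Pendant.liftSet (v 0) u m (runSet n v n n) ∈ U :=
  hU (Pendant.liftSet_mono _ _ _ (runSet_mono (Nat.zero_le _) thrQ_le)) (mem_at_thrQ h)

end Basic

section Constraints

variable (hn : 3 ≤ n) (hinj : ∀ i j, i < n → j < n → v i = v j → i = j) (hper : v n = v 0) (hU : IsUpperSet U)
include hn hinj hper hU

omit hU in
/-- Below the base vertex the clockwise lift is trivial: for `u = v a` (`0 < a < n`) and `i < a`, `L(runSet i 0) = runSet i 0`. [this work] -/
theorem lift_runSet_pre_eq {a i : ℕ} (ha0 : 0 < a) (han : a < n) (hia : i < a) :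
    Pendant.liftSet (v 0) (v a) m (runSet n v i 0) = runSet n v i 0 := by
  refine Quad.liftSet_of_not fun h => ?_
  rw [seen_iff hn hinj hper ha0 han] at h
  omega

omit hU in
/-- Below the base vertex the counter-clockwise lift is trivial: for `u = v a` (`0 < a < n`) and `j < n − a`, `L(runSet 0 j) = runSet 0 j`. [this work] -/
theorem lift_runSet_suf_eq {a j : ℕ} (ha0 : 0 < a) (han : a < n) (hja : j < n - a) :
    Pendant.liftSet (v 0) (v a) m (runSet n v 0 j) = runSet n v 0 j := by
  refine Quad.liftSet_of_not fun h => ?_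
  rw [seen_iff hn hinj hper ha0 han] at h
  omega

/-- **CONSTRAINT** (clockwise): if the threshold of the chain based at `v a` is below `a`, every other clockwise chain is at least as advanced there:
`thrP (v a) m U < a → thrP u′ m′ U ≤ thrP (v a) m U`. [this work] -/
theorem thrP_le_of_lt {a : ℕ} (ha0 : 0 < a) (han : a < n) (u' : V) (m' : Sym2 V) (h : thrP n v (v a) m U < a) :
    thrP n v u' m' U ≤ thrP n v (v a) m U := by
  have hmem := mem_at_thrP (U := U) (lt_trans h han)
  rw [lift_runSet_pre_eq hn hinj hper ha0 han h] at hmem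
  exact thrP_le_of_mem (one_le_thrP (by omega)) (hU (Pendant.subset_liftSet _ _ _ _) hmem)

/-- **CONSTRAINT** (counter-clockwise): `thrQ (v a) m U < n − a → thrQ u′ m′ U ≤ thrQ (v a) m U`. [this work] -/
theorem thrQ_le_of_lt {a : ℕ} (ha0 : 0 < a) (han : a < n) (u' : V) (m' : Sym2 V) (h : thrQ n v (v a) m U < n - a) :
    thrQ n v u' m' U ≤ thrQ n v (v a) m U := by
  have hmem := mem_at_thrQ (U := U) (by omega : thrQ n v (v a) m U < n)
  rw [lift_runSet_suf_eq hn hinj hper ha0 han h] at hmem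
  exact thrQ_le_of_mem (one_le_thrQ (by omega)) (hU (Pendant.subset_liftSet _ _ _ _) hmem)

end Constraints

end Bulk

end Cyc

end Antithetic

end Summit.CriticalPhenomena.PercolationContinuityZ3.Theorems
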